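import Literature.NumberTheory.EllipticCurves.GoodReductionTorsionReductionProofs
import Literature.NumberTheory.EllipticCurves.MazurTateTamePairing
import HarnessLib

/-!
# Route `GenusKolyvaginAtTwo`, crux #2 `GenusPrimitiveSupplyAtTwo` (stmt-BirchSwinnertonDyer-22136):
# THE TWO REDUCTIONS OF A RATIONAL POINT AGREE — `reducePointAt W q P` (the `ℤ_(q)`-local model of
# `MazurTateTamePairing`) versus the reduction of `P ∈ E(ℚ_q)` for the `ℤ_q`-model — and HENSEL read on
# rational points: `P̃ ∈ n·Ẽ(𝔽_q) ↔ P ∈ n·E(ℚ_q)` (`q ∤ n·Δ`)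

Width seat `bsd-line-gk2-p4` g13 (cell `bsd-f1-sign2`). THEOREMS ONLY (no definition, no named fact, no `sorry`);
helper `--supports stmt-BirchSwinnertonDyer-22136`; no item is closed; BSD is not proved by any of this.

WHY. The cell's T-q₀ `F1Sign2.TranspositionDoor.TranspositionTwistLawAtTwo` (Mazur–Rubin 2010 Prop. 3.3 at `T = {q₀}` +
Kramer 1981 Prop. 3) speaks of the door `MeetsNonNormAt W q₀ : ∃ P ∈ E(ℚ), P̃ ∉ 2Ẽ(𝔽_{q₀})` in the currency
`reducePointAt` (reduction of RATIONAL points through the local ring `ℤ_(q) ⊂ ℚ`), while the `2`-Selmer engine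
(`…TwistMenuFrame.natCard_selmerGroup_twist_directed_of_menu_frame`, gk2-p4 g12) reads the door as
«`Sel₂(W)` is not strict at `q₀`», i.e. `P ∉ 2E(ℚ_{q₀})` — a statement about `ℚ_q`-points, where Hensel lives
(tree `WeierstrassCurve.exists_nsmul_eq_iff_reduction`, for the `ℤ_q`-model `integralModelInt W ⊗ ℤ_q`). This file is
the bridge: the residue fields `ℤ_(q)/q` and `ℤ_q/q` are identified (§1), the two models agree over `ℤ_q` (§2), the
two reductions of a rational point correspond under the induced bijection of `𝔽_q`-points (§3), whence
**`exists_smul_reducePointAt_iff_exists_smul_padic`**: `(∃ Q, P̃ = n•Q in Ẽ(𝔽_q)) ↔ (∃ R ∈ E(ℚ_q), n•R = P)` for a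
globally minimal `W`, a good prime `q` and `q ∤ n` (§4).

References: [SilvermanAEC2009] VII.2.1 (reduction mod `𝔪` is a homomorphism onto `Ẽ_ns`, kernel `E₁`), VII.3.1 (b),
IV.2.3 / IV.6.4 (the formal group is uniquely `n`-divisible for `n ∈ ℤ_qˣ`); [Kramer1981] Prop. 3 (the non-norm coset
`E(ℚ_q)/N E(K_w) ≅ Ẽ(𝔽_q)/2Ẽ(𝔽_q)` at a ramified odd good prime).
-/

set_option linter.dupNamespace false -- tree convention: `Summit.BirchSwinnertonDyer.BirchSwinnertonDyer.Theorems` (summit = sub-problem)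
set_option autoImplicit false

noncomputable section

open scoped Classical

namespace Summit.BirchSwinnertonDyer.BirchSwinnertonDyer.Theorems.GenusKolyTransp

open WeierstrassCurve Function
open Literature.NumberTheory.EllipticCurves

variable (q : ℕ) [Fact q.Prime]

/-! ## §1 The residue fields `ℤ_(q)/q` and `ℤ_q/q` -/

/-- **`ℤ_(q) → ℤ_q` and the identification of residue fields.** There are a ring homomorphism
`f : ℤ_(q) → ℤ_q` over `ℚ → ℚ_q` (`ℤ_(q) = {x ∈ ℚ : ‖x‖_q ≤ 1}`, `mem_localIntegers_iff`) and a ring ISOMORPHISM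
`e : ℤ_(q)/q ≃ ℤ_q/q` of residue fields with `e (ā) = (f a)‾` (injective as a field map; onto because every
`q`-adic integer is congruent to a natural number mod `q`, `PadicInt.exists_mem_range`). [folklore]
[cite: SilvermanAEC2009, VII.2 (the residue field of the local ring, PDF p. 166)] -/
theorem exists_ringHom_ringEquiv_residueField :
    ∃ (f : localIntegers q →+* ℤ_[q]) (e : IsLocalRing.ResidueField (localIntegers q) ≃+* IsLocalRing.ResidueField ℤ_[q]),
      (∀ a : localIntegers q, ((f a : ℤ_[q]) : ℚ_[q]) = ((a : ℚ) : ℚ_[q])) ∧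
      ∀ a : localIntegers q, e (IsLocalRing.residue _ a) = IsLocalRing.residue _ (f a) := by
  let f : localIntegers q →+* ℤ_[q] :=
    { toFun := fun a ↦ ⟨((a : ℚ) : ℚ_[q]), (mem_localIntegers_iff q (a : ℚ)).mp a.2⟩
      map_one' := Subtype.ext (by simp)
      map_mul' := fun a b ↦ Subtype.ext (by simp)
      map_zero' := Subtype.ext (by simp)
      map_add' := fun a b ↦ Subtype.ext (by simp) }
  have hf : ∀ a : localIntegers q, ((f a : ℤ_[q]) : ℚ_[q]) = ((a : ℚ) : ℚ_[q]) := fun _ ↦ rfl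
  -- residues vanish simultaneously: both mean `‖a‖_q < 1`
  have hvA := integers_localIntegers q
  have hvB := padicInt_valuationIntegers q
  have hres : ∀ a : localIntegers q,
      IsLocalRing.residue (localIntegers q) a = 0 ↔ IsLocalRing.residue ℤ_[q] (f a) = 0 := by
    intro a
    rw [← v_algebraMap_lt_one_iff hvA, ← v_algebraMap_lt_one_iff hvB]
    change ratAdicValuation q (a : ℚ) < 1 ↔ ‖((f a : ℤ_[q]) : ℚ_[q])‖₊ < 1
    rw [ratAdicValuation_apply, hf]
  -- the induced map of residue fields
  let g : localIntegers q →+* IsLocalRing.ResidueField ℤ_[q] := (IsLocalRing.residue ℤ_[q]).comp f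
  have hg : ∀ a ∈ IsLocalRing.maximalIdeal (localIntegers q), g a = 0 := by
    intro a ha
    exact (hres a).mp ((IsLocalRing.residue_eq_zero_iff _).mpr ha)
  let e₀ : IsLocalRing.ResidueField (localIntegers q) →+* IsLocalRing.ResidueField ℤ_[q] :=
    Ideal.Quotient.lift _ g hg
  have he₀ : ∀ a : localIntegers q, e₀ (IsLocalRing.residue _ a) = IsLocalRing.residue _ (f a) := fun _ ↦ rfl
  have hsurj : Surjective e₀ := by
    intro z
    obtain ⟨x, rfl⟩ := IsLocalRing.residue_surjective z
    obtain ⟨n, -, hn⟩ := PadicInt.exists_mem_range x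
    refine ⟨IsLocalRing.residue _ (n : localIntegers q), ?_⟩
    rw [he₀, map_natCast]
    change IsLocalRing.residue ℤ_[q] (n : ℤ_[q]) = IsLocalRing.residue ℤ_[q] x
    rw [eq_comm, ← sub_eq_zero, ← map_sub, IsLocalRing.residue_eq_zero_iff]
    exact hn
  exact ⟨f, RingEquiv.ofBijective e₀ ⟨e₀.injective, hsurj⟩, hf, he₀⟩


/-! ## §2 The `ℤ_(q)`-local model and the `ℤ_q`-model agree over `ℤ_q` -/

/-- Two affine points with equal coordinates are equal (proof-irrelevance helper). [folklore] -/
private theorem some_eq_some {R : Type*} [CommRing R] {V : WeierstrassCurve R} {x x' y y' : R}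
    (hx : x = x') (hy : y = y') {h : V.toAffine.Nonsingular x y} {h' : V.toAffine.Nonsingular x' y'} :
    Affine.Point.some x y h = Affine.Point.some x' y' h' := by
  subst hx hy
  rfl

/-- **`W_{ℤ_(q)} ⊗ ℤ_q = integralModelInt W ⊗ ℤ_q`**: the local model of a globally minimal `W/ℚ` at `q` (its
coefficients regarded in `ℤ_(q)`), pushed into `ℤ_q` along any `f : ℤ_(q) → ℤ_q` over `ℚ → ℚ_q`, is the `ℤ_q`-model of
the tree's formal-group files; both have base change `W ⊗ ℚ_q` to `ℚ_q` (`baseChange_localModel`, `padicModel_baseChange`)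
and `ℤ_q → ℚ_q` is injective (`WeierstrassCurve.map_injective`). [cite: SilvermanAEC2009, VII.1 (minimal equations over the local ring, PDF p. 165)] -/
theorem map_localModel_eq_padicModel (W : WeierstrassCurve ℚ) [W.IsGloballyMinimal]
    (f : localIntegers q →+* ℤ_[q]) (hf : ∀ a : localIntegers q, ((f a : ℤ_[q]) : ℚ_[q]) = ((a : ℚ) : ℚ_[q])) :
    (W.localModel q).map f = (integralModelInt W).map (Int.castRingHom ℤ_[q]) := by
  have hinj : Injective (algebraMap ℤ_[q] ℚ_[q]) := (padicInt_valuationIntegers q).hom_inj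
  apply WeierstrassCurve.map_injective hinj
  change ((W.localModel q).map f).baseChange ℚ_[q] = ((integralModelInt W).map (Int.castRingHom ℤ_[q])).baseChange ℚ_[q]
  rw [padicModel_baseChange, baseChange, WeierstrassCurve.map_map,
    show W.baseChange ℚ_[q] = ((W.localModel q).baseChange ℚ).baseChange ℚ_[q] by rw [baseChange_localModel],
    baseChange, baseChange, WeierstrassCurve.map_map]
  congr 1
  ext a
  rw [RingHom.comp_apply, RingHom.comp_apply, eq_ratCast]
  exact hf a

/-! ## §3 The two reductions of a rational point correspond -/

/-- **The reductions of a rational point through `ℤ_(q)` and through `ℤ_q` correspond.** For `W/ℚ` globally minimal and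
a prime `q ∤ Δ_W` there is an additive BIJECTION `g : Ẽ(ℤ_(q)/q) → Ẽ'(ℤ_q/q)` between the points of the reduction
`reductionAtPrime W q` (the local model reduced modulo the maximal ideal of `ℤ_(q)`) and those of the reduction of the
`ℤ_q`-model `integralModelInt W ⊗ ℤ_q`, carrying `reducePointAt W q P` to the reduction of `P ∈ E(ℚ) ⊂ E(ℚ_q)` for
EVERY rational point `P` (both are «reduce the coordinates mod `q`», read through the identification
`ℤ_(q)/q ≅ ℤ_q/q` of §1; points with non-`q`-integral abscissa go to `Õ` on both sides).
[cite: SilvermanAEC2009, VII.2 (the reduction map, PDF pp. 166–167)] -/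
theorem exists_reduction_bridge (W : WeierstrassCurve ℚ) [W.IsElliptic] [W.IsGloballyMinimal]
    (hq : ¬ (q : ℤ) ∣ minimalDiscriminantInt W) :
    ∃ g : (reductionAtPrime W q).toAffine.Point →+
        (((integralModelInt W).map (Int.castRingHom ℤ_[q])).map (IsLocalRing.residue ℤ_[q])).toAffine.Point,
      Bijective g ∧ ∀ P : W.toAffine.Point,
        g (reducePointAt W q P) = reducePoint ((integralModelInt W).map (Int.castRingHom ℤ_[q]))
          (Affine.Point.congrEquiv (W.padicModel_baseChange q).symm
            (Affine.Point.baseChange (W' := W) ℚ ℚ_[q] P)) := by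
  obtain ⟨f, e, hf, he⟩ := exists_ringHom_ringEquiv_residueField q
  have hvA := integers_localIntegers q
  have hvB := padicInt_valuationIntegers q
  have hlm := map_localModel_eq_padicModel q W f hf
  set VB : WeierstrassCurve ℤ_[q] := (integralModelInt W).map (Int.castRingHom ℤ_[q]) with hVB
  let eh : IsLocalRing.ResidueField (localIntegers q) →+* IsLocalRing.ResidueField ℤ_[q] := e
  have heh : ∀ u, eh u = e u := fun _ ↦ rfl
  -- the reduced curves correspond along `e`
  have hcurve : (reductionAtPrime W q).map eh = VB.map (IsLocalRing.residue ℤ_[q]) := by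
    rw [← hlm, WeierstrassCurve.map_map, WeierstrassCurve.map_map]
    congr 1
    ext a
    exact he a
  let g : (reductionAtPrime W q).toAffine.Point →+ (VB.map (IsLocalRing.residue ℤ_[q])).toAffine.Point :=
    (Affine.Point.congrEquiv hcurve).toAddMonoidHom.comp ((reductionAtPrime W q).mapPointHom eh)
  have hg_some : ∀ {u v : IsLocalRing.ResidueField (localIntegers q)}
      (h : (reductionAtPrime W q).toAffine.Nonsingular u v),
      ∃ h', g (.some u v h) = .some (e u) (e v) h' := by
    intro u v h
    refine ⟨hcurve ▸ (Affine.map_nonsingular _ eh.injective u v).mpr h, ?_⟩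
    change Affine.Point.congrEquiv hcurve ((reductionAtPrime W q).mapPointHom eh (.some u v h)) = _
    rw [mapPointHom_some, Affine.Point.congrEquiv_some]
    exact some_eq_some (heh u) (heh v)
  have hginj : Injective g :=
    (Affine.Point.congrEquiv hcurve).injective.comp (mapPointHom_injective _ _)
  have hgsurj : Surjective g := by
    rintro (_ | ⟨u, v, h⟩)
    · exact ⟨0, map_zero g⟩
    · have h' : (reductionAtPrime W q).toAffine.Nonsingular (e.symm u) (e.symm v) := by
        rw [← Affine.map_nonsingular _ eh.injective]
        change ((reductionAtPrime W q).map eh).toAffine.Nonsingular _ _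
        rw [hcurve, heh, heh]
        simpa only [RingEquiv.apply_symm_apply] using h
      obtain ⟨h'', hh⟩ := hg_some h'
      exact ⟨_, hh.trans (some_eq_some (e.apply_symm_apply u) (e.apply_symm_apply v))⟩
  refine ⟨g, ⟨hginj, hgsurj⟩, fun P ↦ ?_⟩
  -- compatibility with the two reductions, by cases on the rational point
  have hinjA : Injective (algebraMap (localIntegers q) ℚ) := hvA.hom_inj
  have hinjB : Injective (algebraMap ℤ_[q] ℚ_[q]) := hvB.hom_inj
  haveI hEA : (reductionAtPrime W q).IsElliptic :=
    isElliptic_map_residue (W := W.localModel q) (isUnit_Δ_localModel_of_not_dvd W q hq)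
  rcases P with _ | ⟨x, y, h⟩
  · change g 0 = WeierstrassCurve.reducePoint VB (Affine.Point.congrEquiv (W.padicModel_baseChange q).symm 0)
    rw [map_zero, map_zero, WeierstrassCurve.reducePoint_zero]
  -- the rational point read in `E(ℚ_q)`, then on the `ℤ_q`-model
  obtain ⟨h₁, hbc⟩ : ∃ h₁, Affine.Point.congrEquiv (W.padicModel_baseChange q).symm
      (Affine.Point.baseChange (W' := W) ℚ ℚ_[q] (.some x y h)) = .some ((x : ℚ) : ℚ_[q]) ((y : ℚ) : ℚ_[q]) h₁ := by
    have h₀ : (W.baseChange ℚ_[q]).toAffine.Nonsingular (algebraMap ℚ ℚ_[q] x) (algebraMap ℚ ℚ_[q] y) :=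
      (W.toAffine.baseChange_nonsingular (f := Algebra.ofId ℚ ℚ_[q]) (RingHom.injective _) x y).mpr h
    refine ⟨(W.padicModel_baseChange q).symm ▸ h₀, ?_⟩
    rw [Affine.Point.map_some, Affine.Point.congrEquiv_some]
    rfl
  erw [hbc]
  by_cases hx : ratAdicValuation q x ≤ 1
  · -- integral coordinates `x = a`, `y = b` with `a, b ∈ ℤ_(q)`
    obtain ⟨a, rfl⟩ := hvA.exists_of_le_one hx
    obtain ⟨b, rfl⟩ := hvA.exists_of_le_one (v_Y_le_one_of_v_X_le_one (W := W.localModel q) hvA h.1 hx)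
    have hns : (reductionAtPrime W q).toAffine.Nonsingular (IsLocalRing.residue _ a) (IsLocalRing.residue _ b) := by
      rw [← Affine.equation_iff_nonsingular]
      exact (WeierstrassCurve.Affine.Equation.map (IsLocalRing.residue (localIntegers q))
        ((map_equation_iff (W := W.localModel q) hinjA).mp h.1) : _)
    have hA : reducePointAt W q (.some _ _ h) = .some _ _ hns :=
      WeierstrassCurve.reducePoint_some_algebraMap (W := W.localModel q) hinjA h hns
    obtain ⟨h', hgA⟩ := hg_some hns
    rw [hA, hgA]
    -- the `ℤ_q`-side
    have hns' : (VB.map (IsLocalRing.residue ℤ_[q])).toAffine.Nonsingular (IsLocalRing.residue _ (f a))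
        (IsLocalRing.residue _ (f b)) := by
      rw [← he, ← he]; exact h'
    have hab : ∃ h₂, (Affine.Point.some ((algebraMap (localIntegers q) ℚ a : ℚ) : ℚ_[q])
        ((algebraMap (localIntegers q) ℚ b : ℚ) : ℚ_[q]) h₁ : (VB.baseChange ℚ_[q]).toAffine.Point) =
          .some (algebraMap ℤ_[q] ℚ_[q] (f a)) (algebraMap ℤ_[q] ℚ_[q] (f b)) h₂ :=
      ⟨by rw [show algebraMap ℤ_[q] ℚ_[q] (f a) = _ from hf a, show algebraMap ℤ_[q] ℚ_[q] (f b) = _ from hf b]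
          exact h₁, some_eq_some (hf a).symm (hf b).symm⟩
    obtain ⟨h₂, hab⟩ := hab
    rw [hab, WeierstrassCurve.reducePoint_some_algebraMap hinjB h₂ hns']
    exact some_eq_some (he a) (he b)
  · -- `x ∉ ℤ_(q)`: both reductions are `Õ`
    rw [not_le] at hx
    have hxA : (x : ℚ) ∉ Set.range (algebraMap (localIntegers q) ℚ) := (not_mem_range_iff hvA).mpr hx
    have hxB : ((x : ℚ) : ℚ_[q]) ∉ Set.range (algebraMap ℤ_[q] ℚ_[q]) := by
      rw [not_mem_range_iff hvB]
      rw [ratAdicValuation_apply] at hx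
      exact hx
    have hA : reducePointAt W q (.some _ _ h) = 0 :=
      WeierstrassCurve.reducePoint_some_of_not_mem (W := W.localModel q) h hxA
    rw [hA, map_zero, WeierstrassCurve.reducePoint_some_of_not_mem h₁ hxB]

/-! ## §4 Hensel read on rational points: `P̃ ∈ n·Ẽ(𝔽_q) ↔ P ∈ n·E(ℚ_q)` -/

/-- **`P̃ ∈ n·Ẽ(𝔽_q) ⟺ P ∈ n·E(ℚ_q)` for a rational point `P`** (`W/ℚ` globally minimal, `q ∤ Δ_W` a good prime,
`q ∤ n`): the reduction `reducePointAt W q P` of `P ∈ E(ℚ)` is `n`-divisible in `Ẽ(𝔽_q)` iff `P` is `n`-divisible in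
`E(ℚ_q)`. Silverman *AEC* VII.2.1 (`0 → E₁(ℚ_q) → E(ℚ_q) → Ẽ(𝔽_q) → 0`, onto by Hensel) with `E₁(ℚ_q) ≅ Ê(qℤ_q)` uniquely
`n`-divisible (IV.2.3 / IV.6.4) — the tree's `WeierstrassCurve.exists_nsmul_eq_iff_reduction` for the `ℤ_q`-model —
transported to the `ℤ_(q)`-reduction of rational points by §3. At `n = 2`, `q` odd: Kramer's reading of the local norm
index at a ramified good prime, `E(ℚ_q)/2E(ℚ_q) ≅ Ẽ(𝔽_q)/2Ẽ(𝔽_q)`. [cite: SilvermanAEC2009, Prop. VII.2.1 and Prop. VII.3.1(b)]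
[cite: Kramer1981, Prop. 3] -/
theorem exists_smul_reducePointAt_iff_exists_smul_padic (W : WeierstrassCurve ℚ) [W.IsElliptic] [W.IsGloballyMinimal]
    (hq : ¬ (q : ℤ) ∣ minimalDiscriminantInt W) {n : ℕ} (hn : ¬ q ∣ n) (P : W.toAffine.Point) :
    (∃ Q : (reductionAtPrime W q).toAffine.Point, reducePointAt W q P = n • Q) ↔
      ∃ R : (W.baseChange ℚ_[q]).toAffine.Point, n • R = Affine.Point.baseChange (W' := W) ℚ ℚ_[q] P := by
  obtain ⟨g, hg, hgP⟩ := exists_reduction_bridge q W hq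
  have key := WeierstrassCurve.exists_nsmul_eq_iff_reduction (W := W) hq hn
    (Affine.Point.baseChange (W' := W) ℚ ℚ_[q] P)
  rw [key, ← hgP P]
  constructor
  · rintro ⟨Q, hQ⟩
    exact ⟨g Q, by rw [hQ, map_nsmul]⟩
  · rintro ⟨c, hc⟩
    obtain ⟨Q, rfl⟩ := hg.2 c
    exact ⟨Q, hg.1 (by rw [map_nsmul, hc])⟩

end Summit.BirchSwinnertonDyer.BirchSwinnertonDyer.Theorems.GenusKolyTransp

end
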